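import Summits.HubbardSuperconductivity.HubbardSuperconductivity.Theorems.AnisotropyChordTransferFibre3B1Bracket

/-!
# Route `AnisotropyChord` / H0 rotor rung, LEVEL 2 family B1: the WEIGHTED generic L-uniform bracket (cos-weighted
convolutions such as PartN41-B's `Tx(q)`)

Theory-1 g22's PartN41-B (memo 22 §333–§336) needs, besides the plain named sums `S₂…G13` (instances of `B1.b1Bracket`),
the cos-weighted convolution `Tx(q) = Σ_p g(p) g(q − p) cos(θ(p₁ − q₁/2))` (the gradient tails `τ_e` at the named momenta).
THIS FILE proves the generic bracket with a bounded WEIGHT `w : (ℤ/L)² → ℝ`, `|w| ≤ 1`, which on the window is at least a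
nonnegative L-independent `w_lo`:
  ★ `b1Bracket_weighted`:
  `Σ_{p ∈ idx} (Π_i (|p+s_i|² − ν)^{−a_i})·w_lo(p) − tailConst ν (K−2S) n ≤ θ^{2n} Σ_k (Π_i g(k+s_i)^{a_i})·w(k)
     ≤ hiSum ν θ₀ K S s a + tailConst ν (K−2S) n`
(hypotheses as in `b1Bracket`, plus `|w k| ≤ 1`, `0 ≤ w_lo p ≤ w(toTor p)` on `idx`).  Proof: upper — `T·w ≤ T` and `b1_upper`;
lower — split the torus into the image of `idx` (there `T·w ≥ (Π lower)·w_lo`, `Xf_lower`) and the rest (there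
`T·w ≥ −T ≥ −Σ_j (a_j/n)·G(k + s_j)` by `prod_Xf_le`, whose window term vanishes off `idx`), and the averaged tail sums to
`tailConst` (`tail_majorant_sum_le`, reindexing `k ↦ k + s_j`).  Tools: `rep_toTor_of_mem_box`, `filter_rep_mem_idx`,
`averaged_tail_le`, `scaled_weighted_eq`.
Prover seat `hubbard-h0-rotor-p2` g4; helper for piece A = stmt-HubbardSuperconductivity-23918 of rung 19089
(`--supports`, helper class).  Nothing here proves superconductivity in the Hubbard model; helper lemmas of ONE conditional
reduction (the GM₃ ∀L certificate, Level-2 rows); the rotor TARGET as originally worded stays FALSE (g15 verdict).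
Mathlib + the tree only; no sorry.
-/

set_option linter.dupNamespace false
set_option autoImplicit false

noncomputable section

open scoped BigOperators

namespace Summit.HubbardSuperconductivity.HubbardSuperconductivity.Theorems.AnisotropyChord.Transfer.Fibre3.B1

variable (L : ℕ) [NeZero L]

/-! ## Representatives of box points -/

/-- a point of a box of half-width `M`, `2M < L`, is its own centred representative. [folklore] -/
theorem rep_toTor_of_mem_box (M : ℕ) (h2M : 2 * M < L) (p : ℤ × ℤ) (hp : p ∈ box M) : rep L (toTor L p) = p := by
  rw [mem_box_iff] at hp
  obtain ⟨⟨h1a, h1b⟩, ⟨h2a, h2b⟩⟩ := hp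
  have hM : (2 * M : ℕ) < (L : ℤ) := by exact_mod_cast h2M
  push_cast at hM
  unfold rep toTor
  ext
  · show (((p.1 : ℤ) : ZMod L)).valMinAbs = p.1
    rw [ZMod.valMinAbs_spec]
    refine ⟨rfl, ?_, ?_⟩ <;> omega
  · show (((p.2 : ℤ) : ZMod L)).valMinAbs = p.2
    rw [ZMod.valMinAbs_spec]
    refine ⟨rfl, ?_, ?_⟩ <;> omega

variable {ι : Type*} [Fintype ι]

/-- the momenta whose representative lies in `idx` are exactly the image of `idx` on the torus. [folklore] -/
theorem filter_rep_mem_idx [DecidableEq (Tor L)] (K S : ℕ) (h2KS : 2 * (K + S) < L) (s : ι → ℤ × ℤ) :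
    (Finset.univ.filter fun k : Tor L => rep L k ∈ idx K S s) = (idx K S s).image (toTor L) := by
  ext k
  rw [Finset.mem_filter, Finset.mem_image]
  constructor
  · rintro ⟨-, hk⟩
    exact ⟨rep L k, hk, toTor_rep L k⟩
  · rintro ⟨p, hp, rfl⟩
    refine ⟨Finset.mem_univ _, ?_⟩
    rw [rep_toTor_of_mem_box L (K + S) h2KS p ((mem_idx_iff K S s p).1 hp).1]
    exact hp

/-- the weighted middle quantity as a sum of weighted products of scaled factors. [folklore] -/
theorem scaled_weighted_eq (ν : ℝ) (s : ι → ℤ × ℤ) (a : ι → ℕ) (n : ℕ) (hn : ∑ i, a i = n) (w : Tor L → ℝ) :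
    (2 * Real.pi / L) ^ (2 * n)
        * ∑ k : Tor L, (∏ i, gres L (ν * (2 * Real.pi / L) ^ 2) (k + toTor L (s i)) ^ a i) * w k
      = ∑ k : Tor L, (∏ i, Xf L ν (s i) k ^ a i) * w k := by
  unfold Xf
  rw [Finset.mul_sum]
  refine Finset.sum_congr rfl fun k _ => ?_
  simp_rw [mul_pow]
  rw [Finset.prod_mul_distrib, Finset.prod_pow_eq_pow_sum, ← pow_mul, hn, mul_assoc]

/-- the AVERAGED TAIL: `Σ_k Σ_j (a_j/n)·G(k + s_j) ≤ tailConst ν K' n` (reindex each `j`, `Σ_j a_j/n = 1`,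
`tail_majorant_sum_le`). [folklore] -/
theorem averaged_tail_le (ν : ℝ) (hν0 : 0 ≤ ν) (hν : ν < 4 / Real.pi ^ 2) (K' n : ℕ) (hK'2 : 2 ≤ K')
    (hK'N : K' ≤ L / 2) (h2 : 2 ≤ n) (s : ι → ℤ × ℤ) (a : ι → ℕ) (hn : ∑ i, a i = n) :
    ∑ k : Tor L, ∑ j, ((a j : ℝ) / n) *
        (if rep L (k + toTor L (s j)) ∈ zWindow (L / 2) \ zWindow K' then
            (Real.pi ^ 2 / 4 / (((K' : ℝ) + 1) ^ 2 - ν * Real.pi ^ 2 / 4)) ^ (n - 2)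
              * (Real.pi ^ 2 / 4 / (nsq (rep L (k + toTor L (s j))) - ν * Real.pi ^ 2 / 4)) ^ 2
          else 0)
      ≤ tailConst ν K' n := by
  classical
  have hn0 : n ≠ 0 := by omega
  set G : Tor L → ℝ := fun k' =>
    if rep L k' ∈ zWindow (L / 2) \ zWindow K' then
      (Real.pi ^ 2 / 4 / (((K' : ℝ) + 1) ^ 2 - ν * Real.pi ^ 2 / 4)) ^ (n - 2)
        * (Real.pi ^ 2 / 4 / (nsq (rep L k') - ν * Real.pi ^ 2 / 4)) ^ 2
    else 0 with hG
  have hreindex : ∀ j, ∑ k : Tor L, G (k + toTor L (s j)) = ∑ k : Tor L, G k :=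
    fun j => Equiv.sum_comp (Equiv.addRight (toTor L (s j))) G
  have hsumG : ∑ k : Tor L, G k ≤ tailConst ν K' n := by
    rw [hG]
    exact tail_majorant_sum_le L ν hν0 hν K' n hK'2 hK'N h2
  have hw1 : ∑ j, ((a j : ℝ) / n) = 1 := by
    rw [← Finset.sum_div, ← Nat.cast_sum, hn, div_self (by exact_mod_cast hn0)]
  have e : (∑ k : Tor L, ∑ j, ((a j : ℝ) / n) * G (k + toTor L (s j)))
      = (∑ j, ((a j : ℝ) / n)) * ∑ k : Tor L, G k := by
    rw [Finset.sum_comm, Finset.sum_mul]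
    refine Finset.sum_congr rfl fun j _ => ?_
    rw [← Finset.mul_sum, hreindex j]
  calc (∑ k : Tor L, ∑ j, ((a j : ℝ) / n) * G (k + toTor L (s j)))
      = (∑ j, ((a j : ℝ) / n)) * ∑ k : Tor L, G k := e
    _ ≤ tailConst ν K' n := by rw [hw1, one_mul]; exact hsumG

/-! ## The weighted bracket -/

/-- **THE WEIGHTED GENERIC B1 BRACKET**: for a weight `|w| ≤ 1` on the torus which is at least the nonnegative `w_lo(p)` at the
window points `toTor p`, `p ∈ idx`:
`Σ_{p∈idx} (Π_i (|p+s_i|²−ν)^{−a_i})·w_lo(p) − tailConst ≤ θ^{2n}·Σ_k (Π_i g(k+s_i)^{a_i})·w(k) ≤ hiSum + tailConst`. -/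
theorem b1Bracket_weighted (θ0 : ℝ) (K S : ℕ) (s : ι → ℤ × ℤ) (a : ι → ℕ) (n : ℕ)
    (ha : ∀ i, 1 ≤ a i) (hn : ∑ i, a i = n) (h2 : 2 ≤ n)
    (hS : ∀ i, (s i).1.natAbs ≤ S ∧ (s i).2.natAbs ≤ S) (hK : 2 + 2 * S ≤ K)
    (hθ0 : 2 * Real.pi / L ≤ θ0) (hθ0K : θ0 * K ≤ Real.pi / 2)
    (ν : ℝ) (hν0 : 0 ≤ ν) (hν : ν < 4 / Real.pi ^ 2)
    (w : Tor L → ℝ) (wlo : ℤ × ℤ → ℝ) (hw1 : ∀ k, |w k| ≤ 1)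
    (hwlo0 : ∀ p ∈ idx K S s, 0 ≤ wlo p) (hwlo : ∀ p ∈ idx K S s, wlo p ≤ w (toTor L p)) :
    (∑ p ∈ idx K S s, (∏ i, (1 / (nsq (p + s i) - ν)) ^ a i) * wlo p) - tailConst ν (K - 2 * S) n
        ≤ (2 * Real.pi / L) ^ (2 * n)
          * ∑ k : Tor L, (∏ i, gres L (ν * (2 * Real.pi / L) ^ 2) (k + toTor L (s i)) ^ a i) * w k ∧
      (2 * Real.pi / L) ^ (2 * n)
          * ∑ k : Tor L, (∏ i, gres L (ν * (2 * Real.pi / L) ^ 2) (k + toTor L (s i)) ^ a i) * w k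
        ≤ hiSum ν θ0 K S s a + tailConst ν (K - 2 * S) n := by
  classical
  have h4K := four_mul_le_of_scales L θ0 K hθ0 hθ0K
  have hK'2 : 2 ≤ K - 2 * S := by omega
  have hK'N : K - 2 * S ≤ L / 2 := by omega
  have h2KS : 2 * (K + S) < L := by omega
  rw [scaled_weighted_eq L ν s a n hn w]
  set T : Tor L → ℝ := fun k => ∏ i, Xf L ν (s i) k ^ a i with hT
  have hT0 : ∀ k, 0 ≤ T k := fun k => Finset.prod_nonneg fun i _ => pow_nonneg (Xf_nonneg L ν hν _ _) _
  have hTw_le : ∀ k, T k * w k ≤ T k := fun k => by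
    have := (abs_le.mp (hw1 k)).2
    nlinarith [hT0 k]
  have hTw_ge : ∀ k, -T k ≤ T k * w k := fun k => by
    have := (abs_le.mp (hw1 k)).1
    nlinarith [hT0 k]
  constructor
  · ----------------------------------------------------------------
    -- LOWER
    ----------------------------------------------------------------
    set G : Tor L → ℝ := fun k' =>
      if rep L k' ∈ zWindow (L / 2) \ zWindow (K - 2 * S) then
        (Real.pi ^ 2 / 4 / ((((K - 2 * S : ℕ) : ℝ) + 1) ^ 2 - ν * Real.pi ^ 2 / 4)) ^ (n - 2)
          * (Real.pi ^ 2 / 4 / (nsq (rep L k') - ν * Real.pi ^ 2 / 4)) ^ 2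
      else 0 with hG
    have hG0 : ∀ k, 0 ≤ G k := by
      intro k
      rw [hG]
      dsimp only
      split_ifs
      · have hpi3 := Real.pi_gt_three
        have hc1 : ν * Real.pi ^ 2 / 4 < 1 := by
          rw [div_lt_one (by norm_num)]
          have := (lt_div_iff₀ (by positivity)).mp hν
          linarith
        have hK'R : (2 : ℝ) ≤ ((K - 2 * S : ℕ) : ℝ) := by exact_mod_cast hK'2
        have hD1 : 0 < (((K - 2 * S : ℕ) : ℝ) + 1) ^ 2 - ν * Real.pi ^ 2 / 4 := by nlinarith
        positivity
      · exact le_rfl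
    -- off `idx`, the product is dominated by the averaged tail alone
    have hoff : ∀ k : Tor L, rep L k ∉ idx K S s → T k ≤ ∑ j, ((a j : ℝ) / n) * G (k + toTor L (s j)) := by
      intro k hk
      have h := prod_Xf_le L θ0 K S s a n ha hn h2 hS hK hθ0 hθ0K ν hν k
      rw [if_neg hk, zero_add] at h
      rw [hG]
      exact h
    -- split the torus sum
    have hsplit := Finset.sum_filter_add_sum_filter_not (Finset.univ : Finset (Tor L))
      (fun k => rep L k ∈ idx K S s) (fun k => T k * w k)
    -- the window part
    have hinj : Set.InjOn (toTor L) (idx K S s : Set (ℤ × ℤ)) := by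
      intro p hp q hq hpq
      rw [Finset.mem_coe, mem_idx_iff, mem_box_iff] at hp hq
      exact intCast_eq_of_mem_box L (K + S) h2KS p q hp.1 hq.1 hpq
    have hwin : ∑ p ∈ idx K S s, (∏ i, (1 / (nsq (p + s i) - ν)) ^ a i) * wlo p
        ≤ ∑ k ∈ Finset.univ.filter (fun k => rep L k ∈ idx K S s), T k * w k := by
      rw [filter_rep_mem_idx L K S h2KS s, Finset.sum_image hinj]
      apply Finset.sum_le_sum
      intro p hp
      have hp' := (mem_idx_iff K S s p).1 hp
      have hlow : ∏ i, (1 / (nsq (p + s i) - ν)) ^ a i ≤ T (toTor L p) := by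
        apply Finset.prod_le_prod
        · intro i _
          exact pow_nonneg (lo_nonneg ν hν _ ((mem_zWindow_iff K _).1 (hp'.2 i)).1) _
        · intro i _
          exact pow_le_pow_left₀ (lo_nonneg ν hν _ ((mem_zWindow_iff K _).1 (hp'.2 i)).1)
            (Xf_lower L ν hν K h4K (s i) (toTor L p) (p + s i) (hp'.2 i) (by rw [toTor_add])) _
      have hl0 : 0 ≤ ∏ i, (1 / (nsq (p + s i) - ν)) ^ a i :=
        Finset.prod_nonneg fun i _ => pow_nonneg (lo_nonneg ν hν _ ((mem_zWindow_iff K _).1 (hp'.2 i)).1) _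
      calc (∏ i, (1 / (nsq (p + s i) - ν)) ^ a i) * wlo p
          ≤ T (toTor L p) * wlo p := mul_le_mul_of_nonneg_right hlow (hwlo0 p hp)
        _ ≤ T (toTor L p) * w (toTor L p) := mul_le_mul_of_nonneg_left (hwlo p hp) (hT0 _)
    -- the rest
    have hrest : -(∑ k : Tor L, ∑ j, ((a j : ℝ) / n) * G (k + toTor L (s j)))
        ≤ ∑ k ∈ Finset.univ.filter (fun k => ¬ rep L k ∈ idx K S s), T k * w k := by
      have h1 : ∑ k ∈ Finset.univ.filter (fun k => ¬ rep L k ∈ idx K S s), -(∑ j, ((a j : ℝ) / n) * G (k + toTor L (s j)))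
          ≤ ∑ k ∈ Finset.univ.filter (fun k => ¬ rep L k ∈ idx K S s), T k * w k := by
        apply Finset.sum_le_sum
        intro k hk
        have hk' := (Finset.mem_filter.mp hk).2
        linarith [hoff k hk', hTw_ge k]
      have h2' : ∑ k ∈ Finset.univ.filter (fun k => ¬ rep L k ∈ idx K S s), (∑ j, ((a j : ℝ) / n) * G (k + toTor L (s j)))
          ≤ ∑ k : Tor L, ∑ j, ((a j : ℝ) / n) * G (k + toTor L (s j)) := by
        apply Finset.sum_le_sum_of_subset_of_nonneg (Finset.filter_subset _ _)
        intro k _ _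
        exact Finset.sum_nonneg fun j _ => mul_nonneg (by positivity) (hG0 _)
      rw [Finset.sum_neg_distrib] at h1
      linarith
    have htail : ∑ k : Tor L, ∑ j, ((a j : ℝ) / n) * G (k + toTor L (s j)) ≤ tailConst ν (K - 2 * S) n := by
      rw [hG]
      exact averaged_tail_le L ν hν0 hν (K - 2 * S) n hK'2 hK'N h2 s a hn
    rw [← hsplit]
    linarith
  · ----------------------------------------------------------------
    -- UPPER
    ----------------------------------------------------------------
    have hup := b1_upper L θ0 K S s a n ha hn h2 hS hK hθ0 hθ0K ν hν0 hν
    rw [scaled_torSum_eq L ν s a n hn] at hup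
    calc ∑ k : Tor L, T k * w k ≤ ∑ k : Tor L, T k := Finset.sum_le_sum fun k _ => hTw_le k
      _ ≤ hiSum ν θ0 K S s a + tailConst ν (K - 2 * S) n := hup

end Summit.HubbardSuperconductivity.HubbardSuperconductivity.Theorems.AnisotropyChord.Transfer.Fibre3.B1

end
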